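import Literature.Computability.AlgebraicComplexity.MS2001StableObstructionFirstCriterion
import Literature.Computability.AlgebraicComplexity.SLOrbitQuotientHolds
import HarnessLib

/-!
# GCT I, Thm. 5.1, first criterion over `ℂ` — UNCONDITIONAL
# (the orbit-map quotient theorem `Grosshans1997_thm_1_11_slOrbit_forms` being a theorem of the tree)

Companion (THEOREMS ONLY: no definition, no named fact; D-0026) of
`MS2001StableObstructionFirstCriterion.lean` (GCT I Thm. 5.1, first criterion, over `ℂ`, proved
there modulo the single classical fact `Grosshans1997_thm_1_11_slOrbit_forms`) and of
`SLOrbitQuotientHolds.lean`, where that fact is discharged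
(`Grosshans1997_thm_1_11_slOrbit_forms_holds`, cell `val-lit` programme #7). The four statements of
the former file are restated here WITHOUT the hypothesis `horb`.

Mulmuley–Sohoni 2001 (GCT I), Thm. 5.1 (authors' version p. 20, all.txt L1365–1371 = journal
Thm. 5.1): «Let `H ⊆ G` be the stabilizer of `f ∈ V`, and `Q ⊆ G` the stabilizer of `g ∈ V`.
Suppose `f` is stable with respect to the action of `G`. Then a (nonzero) representation `W` of `G`
is an obstruction for the pair `(f, g)` if `W` contains a trivial `H`-submodule but not a trivial
`Q`-submodule. In other words, if such a `W` exists then `f` cannot lie in the closure of the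
`G`-orbit of `g`.» Here `G = SL_σ(ℂ)`, `V = Sym^m ℂ^σ`; the MULTIPLICITY form of the theorem (the
typed fact `MS2001_thm_5_1`, all algebraically closed fields of characteristic `0`) stays open.
Honest framing: nothing here bears on VP versus VNP.

## References

* [MulmuleySohoniSIAM2001] K. D. Mulmuley, M. Sohoni, *Geometric complexity theory I*, SIAM J.
  Comput. 31 (2001) 496–526, Thm. 5.1 (AV p.20; second proof AV pp.20–21).
* [Grosshans1997] F. D. Grosshans, *Algebraic Homogeneous Spaces and Invariant Theory*, LNM 1673
  (1997), Thm. 1.11.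

## Provenance

Cell `val-lit`, seat `val-lit-t01` generation 6 (row MS2001-A).
-/

noncomputable section

open MvPolynomial Representation

namespace Literature.Computability.AlgebraicComplexity

open Literature.NumberTheory.DiophantineGeometry (IsRationalRep)

variable {σ : Type} [Fintype σ] [LinearOrder σ]

/-- **GCT I, Thm. 5.1, first criterion, general module, over `ℂ` (unconditional)**: if `f` is a
polystable form of degree `m` lying in the orbit closure `Δ[g]` of a form `g` of degree `m`, then
every finite-dimensional rational `GL_σ(ℂ)`-module with a non-zero `SL ∩ G_f`-invariant has a
non-zero `SL ∩ G_g`-invariant.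
[cite: MulmuleySohoniSIAM2001, Thm. 5.1 (AV p.20, all.txt L1365–1369; journal Thm. 5.1)] -/
theorem isAdmissible_stabilizer_of_isPolystable_of_mem_orbitClosure
    {f g : MvPolynomial σ ℂ} {m : ℕ} (hf : f.IsHomogeneous m) (hg : g.IsHomogeneous m)
    (hst : IsPolystable f) (hmem : f ∈ orbitClosure g)
    {V : Type} [AddCommGroup V] [Module ℂ V] [FiniteDimensional ℂ V]
    (ρ : Representation ℂ (GL σ ℂ) V) (hρ : IsRationalRep ρ)
    (hadm : IsAdmissible ρ (slSubgroup σ ℂ ⊓ linStabilizer f)) :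
    IsAdmissible ρ (slSubgroup σ ℂ ⊓ linStabilizer g) :=
  isAdmissible_stabilizer_of_mem_orbitClosure_of_orbitQuotient
    Grosshans1997_thm_1_11_slOrbit_forms_holds hf hg hst hmem ρ hρ hadm

/-- **GCT I, Thm. 5.1, first criterion for `W = Sym^r`, over `ℂ` (unconditional)**: `f` polystable
of degree `m`, `g` a form of degree `m`; if for some `r` there is a non-zero `SL ∩ G_f`-fixed form of
degree `r` but no non-zero `SL ∩ G_g`-fixed one, then `f ∉ Δ[g]`.
[cite: MulmuleySohoniSIAM2001, Thm. 5.1 (AV p.20, all.txt L1365–1371; journal Thm. 5.1)] -/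
theorem MS2001_thm_5_1_first_complex {f g : MvPolynomial σ ℂ} {m : ℕ} (hf : f.IsHomogeneous m)
    (hg : g.IsHomogeneous m) (hst : IsPolystable f) {r : ℕ}
    (hH : fixedForms (slSubgroup σ ℂ) f r ≠ ⊥) (hQ : fixedForms (slSubgroup σ ℂ) g r = ⊥) :
    f ∉ orbitClosure g :=
  MS2001_thm_5_1_first_of_orbitQuotient Grosshans1997_thm_1_11_slOrbit_forms_holds hf hg hst hH hQ

/-- Contrapositive packaging (unconditional): `f` polystable of degree `m`, `f ∈ Δ[g]` ⇒ a non-zero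
`SL ∩ G_f`-fixed form of degree `r` forces a non-zero `SL ∩ G_g`-fixed form of degree `r`.
[cite: MulmuleySohoniSIAM2001, Thm. 5.1 (AV p.20, all.txt L1365–1371; journal Thm. 5.1)] -/
theorem fixedForms_ne_bot_of_isPolystable_of_mem_orbitClosure {f g : MvPolynomial σ ℂ} {m : ℕ}
    (hf : f.IsHomogeneous m) (hg : g.IsHomogeneous m) (hst : IsPolystable f)
    (hmem : f ∈ orbitClosure g) {r : ℕ} (hH : fixedForms (slSubgroup σ ℂ) f r ≠ ⊥) :
    fixedForms (slSubgroup σ ℂ) g r ≠ ⊥ :=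
  fixedForms_ne_bot_of_mem_orbitClosure_of_orbitQuotient
    Grosshans1997_thm_1_11_slOrbit_forms_holds hf hg hst hmem hH

/-- **The instance `dim (Sym^r)^Q = 0 < dim (Sym^r)^H` of the typed multiplicity criterion
`MS2001_thm_5_1`, over `ℂ`, unconditional.**
[cite: MulmuleySohoniSIAM2001, Thm. 5.1 (AV p.20, all.txt L1365–1371; journal Thm. 5.1)] -/
theorem MS2001_thm_5_1_first_finrank_complex {f g : MvPolynomial σ ℂ} {m : ℕ}
    (hf : f.IsHomogeneous m) (hg : g.IsHomogeneous m) (hst : IsPolystable f) {r : ℕ}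
    (hQ : Module.finrank ℂ (fixedForms (slSubgroup σ ℂ) g r) = 0)
    (hH : 0 < Module.finrank ℂ (fixedForms (slSubgroup σ ℂ) f r)) : f ∉ orbitClosure g :=
  MS2001_thm_5_1_first_finrank_of_orbitQuotient Grosshans1997_thm_1_11_slOrbit_forms_holds
    hf hg hst hQ hH

end Literature.Computability.AlgebraicComplexity

end
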